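import Summits.QuantumAdvantage.AdviceFreeQNC0.LinearSelections
import Summits.QuantumAdvantage.AdviceFreeQNC0.CleanGapStrategies

/-!
# OddPrimeWalk — the REGISTER-RIGIDITY REDUCTION at `p = 5` (item 24201, planner qa-qnc0-p2 g31, ARCHITECTURE 31, ask P2-31a)

Cell qa-qnc0, route OddPrimeWalk (support statement `RegisterRigidityReduction`, rank 9); prover qn-prover-3 g19.

THEOREM `oddPrimeWalk_registerRigidityReduction` (pure logic + arithmetic, the planner's PROOF-E final section):
single-class register rigidity `(R₁)` (item 24200) and the end-register law `(E)` (item 24199, PROVED in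
`OddPrimeWalkEndRegisterLawFive`) together give `WalkHardFLinSel 5`.

PROOF.  Take `δ := 1/100` in both hypotheses: `(R₁)` yields `ε₁ > 0`, `D`, `L`, `n₁`; `(E)` at `D, L` yields `n₂`.  Put
`ε := min ε₁ 1`, `θ := 1 − ε/4 (≥ 3/4)`, `n₀ := max n₁ (max n₂ 3)`.  Let `n ≥ n₀`, `c`, a linear-test strategy `y`, and
suppose `#WIN > θ·2ⁿ`.  Then `#LOSE < (ε/4)·2ⁿ ≤ ε₁·#{wt u ≡ 0 (mod 3)}` (the class has `≥ (2ⁿ − 2)/3 ≥ 2ⁿ/4` members,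
`three_mul_card_class_add_two_ge`), so the one-sided hypothesis of `(R₁)` holds for the class `b = 0`; `(R₁)` hands us
`φ, A, B` with an exceptional set of size `≤ 2ⁿ/100`, and `(E)` then bounds `#WIN ≤ (2/3 + 2/100)·2ⁿ < (3/4)·2ⁿ ≤ θ·2ⁿ`,
a contradiction.
WHAT THIS IS NOT: `(R₁)` (item 24200) is NOT proved here; this file closes only the reduction item 24201.
-/

namespace Summit.QuantumAdvantage.AdviceFreeQNC0.OddConfig

open Finset

/-- the weight class `wt u ≡ 0 (mod 3)` of the `n`-cube has at least `2ⁿ/4` members once `n ≥ 3`. -/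
theorem two_pow_div_four_le_card_class_zero {n : ℕ} (hn : 3 ≤ n) :
    (2 : ℝ) ^ n / 4 ≤ ((univ.filter fun u : Fin n → Bool => wt u % 3 = 0).card : ℝ) := by
  have h := three_mul_card_class_add_two_ge n 0
  rw [Nat.zero_mod] at h
  have h' : ((2 ^ n : ℕ) : ℝ) ≤ ((3 * (univ.filter fun u : Fin n → Bool => wt u % 3 = 0).card + 2 : ℕ) : ℝ) := by
    exact_mod_cast h
  push_cast at h'
  have h8 : (8 : ℝ) ≤ (2 : ℝ) ^ n := by
    calc (8 : ℝ) = 2 ^ 3 := by norm_num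
      _ ≤ 2 ^ n := pow_le_pow_right₀ (by norm_num) hn
  linarith

end Summit.QuantumAdvantage.AdviceFreeQNC0.OddConfig

namespace Summit.QuantumAdvantage.QuantumAdvantage.Theorems

open Finset Summit.QuantumAdvantage.AdviceFreeQNC0 Summit.QuantumAdvantage.AdviceFreeQNC0.OddConfig

set_option linter.dupNamespace false in
/-- **Item 24201 `RegisterRigidityReduction`** (route OddPrimeWalk, planner qa-qnc0-p2 g31 ARCHITECTURE 31 (E)): single-class
register rigidity `(R₁)` and the end-register law `(E)` imply `WalkHardFLinSel 5` — typed against the item's literal signature. -/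
theorem oddPrimeWalk_registerRigidityReduction :
    (∀ δ : ℝ, 0 < δ → ∃ ε₁ : ℝ, 0 < ε₁ ∧ ∃ D L n₀ : ℕ, ∀ n ≥ n₀, ∀ h5 : Fact (Nat.Prime 5), ∀ y :
    Fin (n + 1) → (Fin n → Bool) → Bool, @Summit.QuantumAdvantage.AdviceFreeQNC0.LinSel 5 h5 n y → ∀
    c b : ℕ, b < 3 → (((Finset.univ.filter fun u : Fin n → Bool =>
    Summit.QuantumAdvantage.AdviceFreeQNC0.wt u % 3 = b ∧
    Summit.QuantumAdvantage.AdviceFreeQNC0.ringWinU c y u = true).card : ℝ) ≤ ε₁ *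
    ((Finset.univ.filter fun u : Fin n → Bool => Summit.QuantumAdvantage.AdviceFreeQNC0.wt u % 3 =
    b).card : ℝ) ∨ ((Finset.univ.filter fun u : Fin n → Bool =>
    Summit.QuantumAdvantage.AdviceFreeQNC0.wt u % 3 = b ∧
    Summit.QuantumAdvantage.AdviceFreeQNC0.ringWinU c y u = false).card : ℝ) ≤ ε₁ *
    ((Finset.univ.filter fun u : Fin n → Bool => Summit.QuantumAdvantage.AdviceFreeQNC0.wt u % 3 =
    b).card : ℝ)) → ∃ φ : Fin L → Fin n → ZMod 5, ∃ A B : (Fin n → Bool) → (Fin L → ZMod 5) → ℕ →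
    Bool, ((Finset.univ.filter fun u : Fin n → Bool => ¬ (∀ e ∈ Finset.range 3, ∀ e' ∈ Finset.range
    3, ((Finset.univ.filter fun g : Fin (n + 1) => y g u = true ∧ (g.val +
    Summit.QuantumAdvantage.AdviceFreeQNC0.wtPrefix u g.val) % 3 = e).card + (if A (fun i => decide
    (i.val < D) && u i) (fun k => ∑ i : Fin n, if u i = true then φ k i else 0) e = true then 1 else
    0) + (if B (fun i => decide (n ≤ i.val + D) && u i) (fun k => ∑ i : Fin n, if u i = true then φ
    k i else 0) ((e + 2 * Summit.QuantumAdvantage.AdviceFreeQNC0.wt u) % 3) = true then 1 else 0)) %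
    2 = ((Finset.univ.filter fun g : Fin (n + 1) => y g u = true ∧ (g.val +
    Summit.QuantumAdvantage.AdviceFreeQNC0.wtPrefix u g.val) % 3 = e').card + (if A (fun i => decide
    (i.val < D) && u i) (fun k => ∑ i : Fin n, if u i = true then φ k i else 0) e' = true then 1
    else 0) + (if B (fun i => decide (n ≤ i.val + D) && u i) (fun k => ∑ i : Fin n, if u i = true
    then φ k i else 0) ((e' + 2 * Summit.QuantumAdvantage.AdviceFreeQNC0.wt u) % 3) = true then 1
    else 0)) % 2)).card : ℝ) ≤ δ * (2 : ℝ) ^ n) → (∀ δ : ℝ, 0 < δ → ∀ D L : ℕ, ∃ n₀ : ℕ, ∀ n ≥ n₀, ∀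
    c : ℕ, ∀ y : Fin (n + 1) → (Fin n → Bool) → Bool, ∀ φ : Fin L → Fin n → ZMod 5, ∀ A B : (Fin n →
    Bool) → (Fin L → ZMod 5) → ℕ → Bool, ((Finset.univ.filter fun u : Fin n → Bool => ¬ (∀ e ∈
    Finset.range 3, ∀ e' ∈ Finset.range 3, ((Finset.univ.filter fun g : Fin (n + 1) => y g u = true
    ∧ (g.val + Summit.QuantumAdvantage.AdviceFreeQNC0.wtPrefix u g.val) % 3 = e).card + (if A (fun i
    => decide (i.val < D) && u i) (fun k => ∑ i : Fin n, if u i = true then φ k i else 0) e = true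
    then 1 else 0) + (if B (fun i => decide (n ≤ i.val + D) && u i) (fun k => ∑ i : Fin n, if u i =
    true then φ k i else 0) ((e + 2 * Summit.QuantumAdvantage.AdviceFreeQNC0.wt u) % 3) = true then
    1 else 0)) % 2 = ((Finset.univ.filter fun g : Fin (n + 1) => y g u = true ∧ (g.val +
    Summit.QuantumAdvantage.AdviceFreeQNC0.wtPrefix u g.val) % 3 = e').card + (if A (fun i => decide
    (i.val < D) && u i) (fun k => ∑ i : Fin n, if u i = true then φ k i else 0) e' = true then 1
    else 0) + (if B (fun i => decide (n ≤ i.val + D) && u i) (fun k => ∑ i : Fin n, if u i = true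
    then φ k i else 0) ((e' + 2 * Summit.QuantumAdvantage.AdviceFreeQNC0.wt u) % 3) = true then 1
    else 0)) % 2)).card : ℝ) ≤ δ * (2 : ℝ) ^ n → ((Finset.univ.filter fun u : Fin n → Bool =>
    Summit.QuantumAdvantage.AdviceFreeQNC0.ringWinU c y u = true).card : ℝ) ≤ (2 / 3 + 2 * δ) * (2 :
    ℝ) ^ n) → ∀ h5 : Fact (Nat.Prime 5), @Summit.QuantumAdvantage.AdviceFreeQNC0.WalkHardFLinSel 5
    h5 := by
  intro hR hE h5
  obtain ⟨ε₁, hε₁, D, L, n₁, hR1⟩ := hR (1 / 100) (by norm_num)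
  obtain ⟨n₂, hE1⟩ := hE (1 / 100) (by norm_num) D L
  unfold Summit.QuantumAdvantage.AdviceFreeQNC0.WalkHardFLinSel
  refine ⟨1 - min ε₁ 1 / 4, ?_, max n₁ (max n₂ 3), ?_⟩
  · have : 0 < min ε₁ 1 := lt_min hε₁ one_pos
    linarith
  intro n hn c y hlin
  have hn1 : n₁ ≤ n := le_trans (le_max_left _ _) hn
  have hn2 : n₂ ≤ n := le_trans ((le_max_left _ _).trans (le_max_right _ _)) hn
  have hn3 : 3 ≤ n := le_trans ((le_max_right _ _).trans (le_max_right _ _)) hn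
  have hεle : min ε₁ 1 ≤ ε₁ := min_le_left _ _
  have hεle1 : min ε₁ 1 ≤ 1 := min_le_right _ _
  have h2pos : (0 : ℝ) < (2 : ℝ) ^ n := by positivity
  by_contra hcon
  push Not at hcon
  -- the losers number `2ⁿ − #WIN`
  have hsplit := Finset.card_filter_add_card_filter_not (s := (univ : Finset (Fin n → Bool)))
    (p := fun u : Fin n → Bool => ringWinU c y u = true)
  have e : (univ.filter fun u : Fin n → Bool => ¬ ringWinU c y u = true)
      = univ.filter fun u : Fin n → Bool => ringWinU c y u = false := by
    refine filter_congr fun u _ => ?_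
    simp
  rw [e, card_univ, Fintype.card_fun, Fintype.card_bool, Fintype.card_fin] at hsplit
  have hsplitR : ((univ.filter fun u : Fin n → Bool => ringWinU c y u = true).card : ℝ)
      + ((univ.filter fun u : Fin n → Bool => ringWinU c y u = false).card : ℝ) = (2 : ℝ) ^ n := by
    have h' : (((univ.filter fun u : Fin n → Bool => ringWinU c y u = true).card
        + (univ.filter fun u : Fin n → Bool => ringWinU c y u = false).card : ℕ) : ℝ) = ((2 ^ n : ℕ) : ℝ) := by
      rw [hsplit]
    push_cast at h'
    exact h'
  -- the one-sided hypothesis of `(R₁)` for the class `b = 0`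
  have hclass := two_pow_div_four_le_card_class_zero hn3
  have hB : ((univ.filter fun u : Fin n → Bool => wt u % 3 = 0 ∧ ringWinU c y u = false).card : ℝ)
      ≤ ε₁ * ((univ.filter fun u : Fin n → Bool => wt u % 3 = 0).card : ℝ) := by
    have hsub : (univ.filter fun u : Fin n → Bool => wt u % 3 = 0 ∧ ringWinU c y u = false).card
        ≤ (univ.filter fun u : Fin n → Bool => ringWinU c y u = false).card := by
      refine card_le_card fun u hu => ?_
      rw [mem_filter] at hu ⊢
      exact ⟨hu.1, hu.2.2⟩
    have hsubR : ((univ.filter fun u : Fin n → Bool => wt u % 3 = 0 ∧ ringWinU c y u = false).card : ℝ)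
        ≤ ((univ.filter fun u : Fin n → Bool => ringWinU c y u = false).card : ℝ) := by exact_mod_cast hsub
    have hmul : min ε₁ 1 / 4 * (2 : ℝ) ^ n ≤ ε₁ * ((2 : ℝ) ^ n / 4) := by
      rw [div_mul_eq_mul_div, mul_div_assoc]
      exact mul_le_mul_of_nonneg_right hεle (by positivity)
    nlinarith [mul_le_mul_of_nonneg_left hclass hε₁.le]
  obtain ⟨φ, A, B, hX⟩ := hR1 n hn1 h5 y hlin c 0 (by norm_num) (Or.inr hB)
  have hWIN := hE1 n hn2 c y φ A B hX
  nlinarith
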